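import Literature.Probability.Percolation.VoronoiSeparating
import Literature.Probability.Percolation.VoronoiArmEstimates
import Literature.Probability.Percolation.SmirnovContinuumLimit
import Literature.Probability.RandomPlanarGeometry.PlanarDomainsTopology
import Literature.Topology.PlaneTopology.JordanDomainLocalJoin
import HarnessLib

/-!
# Stub `stub_voronoiBoundaryVanish` of line `Sketch` (crux `Target`, stmt-CriticalPhenomena-6431)

Boundary vanishing of the annealed Voronoi separating probabilities
`f_δⁱ(z) = voronoiSepProb (PB.prod PW) (forgetLast R) δ i z` FROM Tassion's one-arm estimate
`VoronoiAnnealedOneArm` (F1, named fact of `VoronoiArmEstimates.lean`): the first half of the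
estimate in Bollobás–Riordan's proof of Claim 23 (*Percolation* (2006), Ch. 7 p. 200,
"`f_δ³(z_δ) = P(E_δ³(z_δ)) = o(1)`"), in ∀-sequence form — for every point `z` of the OPEN arc
`Aᵢ` of a `3`-marked Jordan domain and every family `z_δ → z` of points of `closure Ω`,
`f_δⁱ(z_δ) → 0` as `δ → 0⁺` — for a general `3`-marked domain (`voronoiSepProb_tendsto_zero`)
and then for `forgetLast R` (`stub_voronoiBoundaryVanish`, the registered signature).

Proof.  `z ∉ A_{i+1} ∪ A_{i+2}` (interior points of an arc are off the other arcs,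
`MarkedDomain.exists_pos_forall_mem_arc_of_dist_lt`), so the other arcs are at distance `≥ r > 0`
from `z`.  Given `β > 0`, F1 (`VoronoiAnnealedOneArm.exists_radius` with `ρ = r/2`) gives
`ε ∈ (0, r/2)` such that a black arm from `B̄(w, ε)` to `{dist · w ≥ r/2}` has probability
`≤ β/2` for all small `δ`, uniformly in `w`; uniform local path-connectedness of `closure Ω`
(`exists_joinedIn_closure_ball`) gives `η > 0` such that `z_δ`, once `η`-close to `z`, is joined
to `z` inside `closure Ω ∩ B(z_δ, ε)`.  On `Eⁱ(z_δ)` that join meets the black separating path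
`γ` (else `z_δ` would be joined to `z ∈ Aᵢ` off `γ`), and `γ` starts on `A_{i+1}`, at distance
`≥ r - r/2 = r/2` from `z_δ`: the reversed initial piece of `γ` (`exists_subpath`) is a black arm
from `B̄(z_δ, ε)` to `{dist · z_δ ≥ r/2}` (`boundaryVanish_arm`).  Hence
`f_δⁱ(z_δ) ≤ β/2 < β` eventually (`measureReal_mono`).
-/

noncomputable section

namespace Summit.CriticalPhenomena.CardyFormulaZ2.Theorems.CardyFlipRussoTarget

open MeasureTheory Filter Set Metric
open scoped Topology
open Literature.Analysis.FunctionSpaces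
open Literature.Probability.RandomPlanarGeometry
open Literature.Probability.RandomPlanarGeometry.MarkedDomain (forgetLast)
open Literature.Probability.LatticeModels
open Literature.Probability.Percolation
open Literature.Topology.PlaneTopology

/-! ### The deterministic core: a separating path near `Aᵢ` carries a black arm -/

/-- **On `Eⁱ(z')`, a black arm at `z'`.**  Deterministic core of the boundary estimate
(Bollobás–Riordan, proof of Claim 23, p. 200): if `z'` is joined to a point `z` of the arc `Aᵢ`
inside `closure Ω ∩ B(z', ε)`, the arc `A_{i+1}` stays at distance `≥ 2ρ` from `z`, and
`dist z' z ≤ ρ`, then every black `A_{i+1}`–`A_{i+2}` path cutting `z'` from `Aᵢ` contains a black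
arm from `B̄(z', ε)` to `{dist · z' ≥ ρ}`. -/
theorem boundaryVanish_arm {D : MarkedDomain 3} {i : Fin 3} {δ ε ρ : ℝ} {z z' : ℂ} {B W : Set ℂ}
    (hz : z ∈ D.arc i) (hfar : ∀ x ∈ D.arc (i + 1), 2 * ρ ≤ dist x z)
    (hτ : JoinedIn (closure D.carrier ∩ ball z' ε) z' z) (hzz' : dist z' z ≤ ρ)
    (hE : voronoiSepEvent D δ i z' B W) :
    ∃ (a b : ℂ) (γ : Path a b), dist a z' ≤ ε ∧ ρ ≤ dist b z' ∧
      ∀ t, (γ t : ℂ) / (δ : ℂ) ∈ blackRegion B W := by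
  obtain ⟨x, hx, y, hy, γ, hγ, hcut⟩ := hE
  -- the separating path enters the ball `B(z', ε)` containing the join of `z'` to `z ∈ Aᵢ`
  have hnear : ∃ t₀, dist (γ t₀) z' < ε := by
    by_contra hno
    refine hcut.2 z hz (hτ.mono ?_)
    rintro p ⟨hp, hpz⟩
    refine ⟨hp, ?_⟩
    rintro ⟨t, rfl⟩
    exact hno ⟨t, mem_ball.1 hpz⟩
  obtain ⟨t₀, ht₀⟩ := hnear
  -- the reversed initial piece `γ t₀ ↝ γ 0 = x ∈ A_{i+1}` is the arm
  obtain ⟨a, b, γ', ha, hb, hsub⟩ := exists_subpath γ t₀ 0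
  refine ⟨a, b, γ', by rw [ha]; exact ht₀.le, ?_, fun t => ?_⟩
  · rw [hb, γ.source]
    have h2 := hfar x hx
    linarith [dist_triangle x z' z]
  · obtain ⟨s, hs⟩ := hsub ⟨t, rfl⟩
    rw [← hs]
    exact (hγ s).2

/-! ### The estimate -/

/-- **Boundary vanishing of annealed Voronoi separating probabilities from F1** (Bollobás–Riordan,
proof of Claim 23, p. 200), for a general `3`-marked Jordan domain: for a parameter `u` strictly
between `mark i` and `nextMark i` (so that `boundary u` is an interior point of the arc `Aᵢ`) and
any family `z_δ → boundary u` of points of `closure Ω`, `f_δⁱ(z_δ) → 0` as `δ → 0⁺`. -/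
theorem voronoiSepProb_tendsto_zero (hF1 : VoronoiAnnealedOneArm)
    {PB PW : Measure (PointConfig ℂ)} (hB : IsPoissonPointProcess (volume : Measure ℂ) PB)
    (hW : IsPoissonPointProcess (volume : Measure ℂ) PW) (D : MarkedDomain 3) (i : Fin 3)
    {u : ℝ} (hu : u ∈ Ioo (D.mark i) (D.nextMark i)) {zs : ℝ → ℂ}
    (hzs : ∀ᶠ δ : ℝ in 𝓝[>] 0, zs δ ∈ closure D.carrier)
    (hlim : Tendsto zs (𝓝[>] 0) (𝓝 (D.boundary u))) :
    Tendsto (fun δ => voronoiSepProb (PB.prod PW) D δ i (zs δ)) (𝓝[>] 0) (𝓝 0) := by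
  haveI := hB.isProbabilityMeasure
  haveI := hW.isProbabilityMeasure
  set z : ℂ := D.boundary u with hzdef
  have hzarc : z ∈ D.arc i := ⟨u, Ioo_subset_Icc_self hu, rfl⟩
  have hzcl : z ∈ closure D.carrier := frontier_subset_closure (D.arc_subset_frontier i hzarc)
  -- the other arcs are at distance `≥ r` from `z`
  obtain ⟨r, hr0, -, hfar⟩ := D.exists_pos_forall_mem_arc_of_dist_lt i hu
  have hne : ∀ j : Fin 3, j + 1 ≠ j := by decide
  have hfar' : ∀ x ∈ D.arc (i + 1), 2 * (r / 2) ≤ dist x z := fun x hx => by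
    have := hfar (i + 1) (hne i) x hx
    linarith
  rw [Metric.tendsto_nhds]
  intro β hβ
  obtain ⟨ε, ⟨hε0, -⟩, hF1ev⟩ := hF1.exists_radius hB hW (half_pos hβ) (half_pos hr0)
  obtain ⟨η, hη0, hjoin⟩ := exists_joinedIn_closure_ball D.toJordanDomain hε0
  have hclose : ∀ᶠ δ : ℝ in 𝓝[>] 0, dist (zs δ) z < min η (r / 2) :=
    Metric.tendsto_nhds.1 hlim _ (lt_min hη0 (half_pos hr0))
  filter_upwards [hF1ev, hzs, hclose] with δ hδ1 hδ2 hδ3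
  rw [Real.dist_eq, sub_zero, abs_of_nonneg voronoiSepProb_nonneg]
  have hτ : JoinedIn (closure D.carrier ∩ ball (zs δ) ε) (zs δ) z :=
    hjoin (zs δ) hδ2 z hzcl (hδ3.trans_le (min_le_left _ _))
  have hsub : {c : PointConfig ℂ × PointConfig ℂ |
        voronoiSepEvent D δ i (zs δ) (c.1 : Set ℂ) (c.2 : Set ℂ)} ⊆
      {c | ∃ (a b : ℂ) (γ : Path a b), dist a (zs δ) ≤ ε ∧ r / 2 ≤ dist b (zs δ) ∧
        ∀ t, (γ t : ℂ) / (δ : ℂ) ∈ blackRegion (c.1 : Set ℂ) (c.2 : Set ℂ)} := fun c hc =>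
    boundaryVanish_arm hzarc hfar' hτ (hδ3.le.trans (min_le_right _ _)) hc
  calc voronoiSepProb (PB.prod PW) D δ i (zs δ)
      ≤ (PB.prod PW).real {c | ∃ (a b : ℂ) (γ : Path a b), dist a (zs δ) ≤ ε ∧
          r / 2 ≤ dist b (zs δ) ∧
          ∀ t, (γ t : ℂ) / (δ : ℂ) ∈ blackRegion (c.1 : Set ℂ) (c.2 : Set ℂ)} :=
        measureReal_mono hsub
    _ ≤ β / 2 := hδ1 (zs δ)
    _ < β := half_lt_self hβ

/-- STUB 3c′ of line `Sketch` — **boundary vanishing of the annealed Voronoi separating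
probabilities of `forgetLast R` from Tassion's one-arm estimate F1** (Bollobás–Riordan, proof of
Claim 23, p. 200, ∀-sequence form): the registered signature, by `voronoiSepProb_tendsto_zero`. -/
theorem stub_voronoiBoundaryVanish : VoronoiAnnealedOneArm →
    ∀ (PB PW : Measure (PointConfig ℂ)),
    IsPoissonPointProcess (volume : Measure ℂ) PB → IsPoissonPointProcess (volume : Measure ℂ) PW →
    ∀ (R : ConformalRectangle) (i : Fin 3),
      ∀ z ∈ (forgetLast R).boundary '' Ioo ((forgetLast R).mark i) ((forgetLast R).nextMark i),
        ∀ zs : ℝ → ℂ, (∀ᶠ δ : ℝ in 𝓝[>] 0, zs δ ∈ closure R.carrier) →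
          Tendsto zs (𝓝[>] 0) (𝓝 z) →
          Tendsto (fun δ => voronoiSepProb (PB.prod PW) (forgetLast R) δ i (zs δ))
            (𝓝[>] 0) (𝓝 0) := by
  intro hF1 PB PW hB hW R i z hz zs hzs hlim
  obtain ⟨u, hu, rfl⟩ := hz
  exact voronoiSepProb_tendsto_zero hF1 hB hW (forgetLast R) i hu hzs hlim

end Summit.CriticalPhenomena.CardyFormulaZ2.Theorems.CardyFlipRussoTarget

end
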